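import Mathlib
import Literature.FieldTheory.RealClosed.TraceFormFibres
import Literature.NumberTheory.NumberFields.LenstraDifferentBound
import HarnessLib

/-!
# Real fibres of a real-rooted family are unramified (Hanselka 2017, Cor. 3.5 with Lemma 2.3)

Topic `Literature/AlgebraicGeometry/DeterminantalHypersurfaces`. C. Hanselka, *Characteristic
polynomials of symmetric matrices over the univariate polynomial ring*, J. Algebra 487 (2017)
340–356 (arXiv:1610.06634), **Corollary 3.5**: "Let `f ∈ ℝ[x,t]` be irreducible and denote
`K := ℝ(x)` and `L := K[t]/(f)`. If `f` is real rooted in a neighborhood of `a ∈ ℝ` then the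
`(x − a)`-adic valuation of `K` is unramified in `L|K`", combined — exactly as in the proof of
Hanselka's Theorem 1 (ibid. §5: "the extension `B|A` is unramified in all real primes of `A` by
Corollary 3.5. Therefore, `v_𝔮(Δ) = 0` for all real primes `𝔮 ∈ 𝓘_B` by Lemma 2.3") — with
**Lemma 2.3** ("the support of the codifferent only contains ramified primes", Mathlib's
`not_dvd_differentIdeal_iff`). Here `B` is the integral closure of `A = ℝ[x]` in `L` and the
hypothesis is real rootedness of every fibre `f(a, ·)`, `a ∈ ℝ` (the hypothesis of Theorem 1,
in the form `H` of `laxConjecture_of_symmSpectralRepresentation`):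

* `not_sq_dvd_and_not_dvd_differentIdeal_of_realRooted` — **Cor. 3.5 + Lemma 2.3**: for every
  real `a` and every prime `𝔮` of `B` containing `x − a`, `𝔮² ∤ (x − a)B` (ramification index
  `1`) and `𝔮 ∤ 𝔇_{B|ℝ[x]}` (so the codifferent `Δ = 𝔇⁻¹` has `v_𝔮(Δ) = 0`);
  `isUnramifiedAt_of_realRooted` — the same in Mathlib's language `Algebra.IsUnramifiedAt`;
* `exists_mul_self_eq_neg_one_of_dvd_differentIdeal` — consequently every non-zero prime of
  `B` dividing `𝔇_{B|ℝ[x]}` is non-real (`−1` is a square in its residue ring), i.e. "`v_𝔮(Δ) = 0`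
  for all real primes `𝔮`" (ibid. §5), the input of Hanselka's Cor. 4.2.

The printed proof of Cor. 3.5 goes through the two orderings of `ℝ((x))` and the structure of
its finite extensions (Lemmas 3.3, 3.4). Mathlib has no real closed fields / real spectra, so we
give instead a self-contained argument with the trace form and the different, using only
Sylvester's positivity (Hanselka's Cor. 3.1, files `TraceFormRealRooted.lean` and
`TraceFormFibres.lean` of `Literature/FieldTheory/RealClosed`) as real input:

1. `eval_intTrace_mul_self_nonneg` — for `u ∈ B` the polynomial `Tr_{B|ℝ[x]}(u²) ∈ ℝ[x]` is
   `≥ 0` on `ℝ` (by `Literature.FieldTheory.RealClosed.exists_sq_mul_trace_mul_self_eq`,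
   `D² Tr(u²) = P` with `P ≥ 0` on `ℝ` and `D ≠ 0`; a polynomial which is `≥ 0` wherever
   `D ≠ 0` is `≥ 0` everywhere, `eval_nonneg_of_sq_mul_eval_nonneg`);
2. `intTrace_mul_mem_sq_of_realRooted` — hence for `z, w` in the radical of `(x − a)B`
   (nilpotent modulo `(x − a)`, so `Tr(z²)(a) = 0`) the non-negative polynomial `Tr(z²)` has a
   double zero at `a`, and by polarisation `Tr(zw) ∈ (x − a)²`;
3. `not_sq_dvd_and_not_dvd_differentIdeal_of_trace_radical` — a general statement on Dedekind
   extensions `A ⊆ B` and a maximal `p ⊂ A` with residue characteristic `0`: if `Tr(zw) ∈ p²`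
   for all `z, w ∈ √(pB)`, then `pB` is square-free and no prime over `p` divides `𝔇_{B|A}`.
   Indeed, writing `pB = 𝔮ᵉQ` (`𝔮 ∤ Q`): the element `≡ (1,0)` of `B/𝔮ᵉ × B/Q` has trace
   `dim B/𝔮ᵉ ≠ 0 (mod p)`, so `𝔮ᵉ ∤ 𝔇` (`not_dvd_differentIdeal_of_isCoprime_of_charZero`, the
   tame bound, from Mathlib's `not_dvd_differentIdeal_of_intTrace_not_mem`); while
   `Tr((𝔮Q)²) ⊆ p²` gives `𝔮^{2e−2} ∣ 𝔇` (`dvd_differentIdeal_of_forall_intTrace_mem`, the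
   `p²`-analogue of Mathlib's `pow_sub_one_dvd_differentIdeal`); thus `2e − 2 < e`, `e = 1`.

All statements are theorems; no definitions, no named facts. The Dedekind-domain lemmas are
stated for an arbitrary "AKLB square" with given fraction fields `K ⊆ L` (`L/K` finite
separable); separability is transported to Mathlib's `FractionRing`s internally by
`Literature.NumberTheory.NumberFields.isSeparable_fractionRing_of_isSeparable`. For
`B = integralClosure ℝ[x] L` the instance hypotheses of the real theorems are supplied by
`IsIntegralClosure.isDedekindDomain ℝ[X] K L`, `IsIntegralClosure.finite ℝ[X] K L` and
`isTorsionFree_iff_algebraMap_injective` (torsion-freeness of `L`, hence of the subalgebra).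

## References

* [Hanselka2017] C. Hanselka, J. Algebra 487 (2017) 340–356: Lemma 2.3, Cor. 3.1, Cor. 3.5, §5.
* J.-P. Serre, *Corps locaux*, Ch. III §§3–6 (different, unramified primes).
-/

noncomputable section

open Polynomial nonZeroDivisors Module

namespace Literature.AlgebraicGeometry.DeterminantalHypersurfaces

/-! ### Dedekind extensions: traces and the different -/

section Dedekind

variable (A K L : Type*) {B : Type*} [CommRing A] [Field K] [CommRing B] [Field L]
  [Algebra A K] [Algebra B L] [Algebra A B] [Algebra K L] [Algebra A L]
  [IsScalarTower A K L] [IsScalarTower A B L]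
  [IsFractionRing A K] [IsFractionRing B L] [IsDedekindDomain A] [IsDedekindDomain B]
  [Module.IsTorsionFree A B] [Module.Finite A B] [FiniteDimensional K L]
  [Algebra.IsSeparable K L]

include K L in
/-- `I`-version of Mathlib's `pow_sub_one_dvd_differentIdeal_aux`: if `D * a = I B` (ideals of
`B`, `I` a non-zero ideal of `A`) and the traces of all elements of `a` lie in `I`, then `D`
divides the different `𝔇_{B/A}`. [folklore] -/
theorem dvd_differentIdeal_of_forall_intTrace_mem {I : Ideal A} (hI : I ≠ ⊥) (D a : Ideal B)
    (ha : D * a = I.map (algebraMap A B)) (H : ∀ x ∈ a, Algebra.intTrace A B x ∈ I) :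
    D ∣ differentIdeal A B := by
  have hI' := (Ideal.map_eq_bot_iff_of_injective
    (FaithfulSMul.algebraMap_injective A B)).not.mpr hI
  have hDbot : D ≠ ⊥ := by
    rintro rfl
    exact hI' (by rw [← ha, Ideal.bot_mul])
  have habot : a ≠ ⊥ := by
    rintro rfl
    exact hI' (by rw [← ha, Ideal.mul_bot])
  have hD : ((D :)⁻¹ : FractionalIdeal B⁰ L) = a / I.map (algebraMap A B) := by
    apply inv_involutive.injective
    simp only [inv_inv, ← ha, FractionalIdeal.coeIdeal_mul, inv_div, mul_div_assoc]
    rw [div_self (by simpa), mul_one]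
  rw [Ideal.dvd_iff_le, differentialIdeal_le_iff (K := K) (L := L) hDbot, hD,
    Submodule.map_le_iff_le_comap]
  intro x hx
  rw [Submodule.restrictScalars_mem, FractionalIdeal.mem_coe,
    FractionalIdeal.mem_div_iff_of_ne_zero (by simpa using hI')] at hx
  rw [Submodule.mem_comap, LinearMap.coe_restrictScalars, ← FractionalIdeal.coe_one,
    ← div_self (G₀ := FractionalIdeal A⁰ K) (a := I) (by simpa using hI),
    FractionalIdeal.mem_coe, FractionalIdeal.mem_div_iff_of_ne_zero (by simpa using hI)]
  simp only [FractionalIdeal.mem_coeIdeal, forall_exists_index, and_imp,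
    forall_apply_eq_imp_iff₂] at hx
  intro y hy'
  obtain ⟨y, hy, rfl : algebraMap A K _ = _⟩ := (FractionalIdeal.mem_coeIdeal _).mp hy'
  obtain ⟨z, hz, hz'⟩ := hx _ (Ideal.mem_map_of_mem _ hy)
  have : Algebra.trace K L (algebraMap B L z) ∈ (I : FractionalIdeal A⁰ K) := by
    rw [← Algebra.algebraMap_intTrace (A := A)]
    exact ⟨Algebra.intTrace A B z, H z hz, rfl⟩
  rwa [mul_comm, ← smul_eq_mul, ← map_smul, Algebra.smul_def, mul_comm,
    ← IsScalarTower.algebraMap_apply, IsScalarTower.algebraMap_apply A B L, ← hz']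

omit [FiniteDimensional K L] in
include K L in
/-- **Tame bound.** If `p B = P * Q` with `P, Q` coprime, `P ≠ B`, and the residue field of the
maximal ideal `p` has characteristic zero, then `P` does not divide the different: the element
`x ≡ (1, 0)` of `B/pB ≅ B/P × B/Q` has trace `dim (B/P) ≠ 0`. [folklore] -/
theorem not_dvd_differentIdeal_of_isCoprime_of_charZero {p : Ideal A} [p.IsMaximal]
    [CharZero (A ⧸ p)] (P Q : Ideal B) (hPtop : P ≠ ⊤) (hPQ : IsCoprime P Q)
    (hP : P * Q = p.map (algebraMap A B)) : ¬ P ∣ differentIdeal A B := by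
  letI := FractionRing.liftAlgebra A (FractionRing B)
  haveI := FractionRing.isScalarTower_liftAlgebra A (FractionRing B)
  haveI := Literature.NumberTheory.NumberFields.isSeparable_fractionRing_of_isSeparable A K L B
  letI := Ideal.Quotient.field p
  obtain ⟨u, hu, v, hv, huv⟩ := Ideal.isCoprime_iff_exists.mp hPQ
  letI : Algebra (A ⧸ p) (B ⧸ Q) := Ideal.Quotient.algebraQuotientOfLEComap (by
      rw [← Ideal.map_le_iff_le_comap, ← hP]
      exact Ideal.mul_le_left)
  letI : Algebra (A ⧸ p) (B ⧸ P) := Ideal.Quotient.algebraQuotientOfLEComap (by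
      rw [← Ideal.map_le_iff_le_comap, ← hP]
      exact Ideal.mul_le_right)
  have : IsScalarTower A (A ⧸ p) (B ⧸ P) := .of_algebraMap_eq' rfl
  have : Module.Finite (A ⧸ p) (B ⧸ P) :=
    Module.Finite.of_restrictScalars_finite A (A ⧸ p) (B ⧸ P)
  have : IsScalarTower A (A ⧸ p) (B ⧸ Q) := .of_algebraMap_eq' rfl
  have : Module.Finite (A ⧸ p) (B ⧸ Q) :=
    Module.Finite.of_restrictScalars_finite A (A ⧸ p) (B ⧸ Q)
  haveI : Nontrivial (B ⧸ P) := Ideal.Quotient.nontrivial_iff.mpr hPtop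
  let e : (B ⧸ p.map (algebraMap A B)) ≃ₐ[A ⧸ p] ((B ⧸ P) × B ⧸ Q) :=
    { __ := (Ideal.quotEquivOfEq hP.symm).trans (Ideal.quotientMulEquivQuotientProd P Q hPQ),
      commutes' := Quotient.ind fun _ ↦ rfl }
  refine not_dvd_differentIdeal_of_intTrace_not_mem A P Q hP v hv ?_
  rw [← Ideal.Quotient.eq_zero_iff_mem, ← Algebra.trace_quotient_eq_of_isDedekindDomain,
    ← Algebra.trace_eq_of_algEquiv e, Algebra.trace_prod_apply]
  have hv1 : (e (Ideal.Quotient.mk _ v)).1 = 1 := by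
    change Ideal.Quotient.mk P v = 1
    have hv' : v = 1 - u := by rw [← huv]; ring
    rw [hv', map_sub, map_one, Ideal.Quotient.eq_zero_iff_mem.mpr hu, sub_zero]
  have hv2 : (e (Ideal.Quotient.mk _ v)).2 = 0 := by
    change Ideal.Quotient.mk Q v = 0
    exact Ideal.Quotient.eq_zero_iff_mem.mpr hv
  rw [hv1, hv2, map_zero, add_zero, ← map_one (algebraMap (A ⧸ p) (B ⧸ P)),
    Algebra.trace_algebraMap, nsmul_eq_mul, mul_one]
  exact Nat.cast_ne_zero.mpr (Module.finrank_pos (R := A ⧸ p) (M := B ⧸ P)).ne'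

include K L in
/-- **No higher ramification from second-order vanishing of traces.** Let `p` be a maximal
ideal of `A` with residue field of characteristic zero, and suppose that
`Tr_{B/A}(z w) ∈ p²` for all `z, w` in the radical of `p B`. Then `p B` is square-free:
no prime `q` of `B` has `q² ∣ p B`, and no prime over `p` divides the different. [folklore] -/
theorem not_sq_dvd_and_not_dvd_differentIdeal_of_trace_radical {p : Ideal A} [p.IsMaximal]
    [CharZero (A ⧸ p)] (hp : p ≠ ⊥)
    (H : ∀ z ∈ (p.map (algebraMap A B)).radical, ∀ w ∈ (p.map (algebraMap A B)).radical,
      Algebra.intTrace A B (z * w) ∈ p ^ 2)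
    (q : Ideal B) [q.IsPrime] (hq : q ∣ p.map (algebraMap A B)) :
    ¬ q ^ 2 ∣ p.map (algebraMap A B) ∧ ¬ q ∣ differentIdeal A B := by
  classical
  set P := p.map (algebraMap A B) with hPdef
  have hP0 : P ≠ ⊥ :=
    (Ideal.map_eq_bot_iff_of_injective (FaithfulSMul.algebraMap_injective A B)).not.mpr hp
  have hq0 : q ≠ ⊥ := by
    rintro rfl
    obtain ⟨c, hc⟩ := hq
    exact hP0 (by rw [hc, Ideal.bot_mul])
  haveI : q.IsMaximal := Ideal.IsPrime.isMaximal inferInstance hq0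
  have hqtop : q ≠ ⊤ := Ideal.IsPrime.ne_top inferInstance
  -- `P = q ^ e * Q` with `q, Q` coprime and `e ≥ 1`
  obtain ⟨Q, hqQ, hfac⟩ := Ideal.eq_prime_pow_mul_coprime hP0 q
  set e := Multiset.count q (UniqueFactorizationMonoid.normalizedFactors P) with he
  have hcop : IsCoprime q Q := Ideal.isCoprime_iff_sup_eq.mpr hqQ
  have he1 : 1 ≤ e := by
    rw [he]
    have hqmem : q ∈ UniqueFactorizationMonoid.normalizedFactors P :=
      (Ideal.mem_normalizedFactors_iff hP0).mpr ⟨inferInstance, Ideal.le_of_dvd hq⟩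
    exact Multiset.one_le_count_iff_mem.mpr hqmem
  -- tame bound: `¬ q ^ e ∣ 𝔇`
  have hqe_top : q ^ e ≠ ⊤ := by
    intro h
    have h' : q ^ e ≤ q := Ideal.pow_le_self (by omega)
    rw [h, top_le_iff] at h'
    exact hqtop h'
  have htame : ¬ q ^ e ∣ differentIdeal A B :=
    not_dvd_differentIdeal_of_isCoprime_of_charZero A K L (q ^ e) Q hqe_top hcop.pow_left
      hfac.symm
  -- lower bound: `q ^ (2e - 2) ∣ 𝔇`
  have hrad : ∀ x ∈ q * Q, x ∈ P.radical := by
    intro x hx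
    refine ⟨e, ?_⟩
    have h1 : (q * Q) ^ e ≤ P := by
      rw [hfac, mul_pow]
      exact Ideal.mul_mono_right (Ideal.pow_le_self (by omega))
    exact h1 (Ideal.pow_mem_pow hx e)
  have hlow : q ^ (2 * e - 2) ∣ differentIdeal A B := by
    refine dvd_differentIdeal_of_forall_intTrace_mem A K L (I := p ^ 2) (pow_ne_zero 2 hp)
      (q ^ (2 * e - 2)) ((q * Q) ^ 2) ?_ ?_
    · rw [Ideal.map_pow, ← hPdef, hfac, mul_pow, ← mul_assoc, ← pow_add, mul_pow, ← pow_mul,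
        show 2 * e - 2 + 2 = e * 2 by omega]
    · intro x hx
      rw [pow_two] at hx
      refine Submodule.mul_induction_on hx (fun z hz w hw => H z (hrad z hz) w (hrad w hw)) ?_
      intro x y hx hy
      rw [map_add]
      exact Ideal.add_mem _ hx hy
  -- conclusion
  have he_eq : e = 1 := by
    by_contra hne
    exact htame ((pow_dvd_pow q (by omega : e ≤ 2 * e - 2)).trans hlow)
  refine ⟨fun h2 => ?_, by rw [← pow_one q, ← he_eq]; exact htame⟩
  have hprime : Prime q := Ideal.prime_of_isPrime hq0 inferInstance
  have hmult := (pow_dvd_iff_le_emultiplicity).mp h2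
  rw [UniqueFactorizationMonoid.emultiplicity_eq_count_normalizedFactors hprime.irreducible hP0,
    normalize_eq, ← he, he_eq] at hmult
  norm_num at hmult

/-- Traces of elements of the radical of `pB` lie in `p` (they are nilpotent on `B/pB`).
[folklore] -/
theorem intTrace_mem_of_mem_radical {p : Ideal A} [p.IsMaximal] {u : B}
    (hu : u ∈ (p.map (algebraMap A B)).radical) : Algebra.intTrace A B u ∈ p := by
  rw [← Ideal.Quotient.eq_zero_iff_mem, ← Algebra.trace_quotient_eq_of_isDedekindDomain,
    ← isNilpotent_iff_eq_zero]
  refine Algebra.isNilpotent_trace_of_isNilpotent ?_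
  obtain ⟨k, hk⟩ := hu
  exact ⟨k, by rw [← map_pow, Ideal.Quotient.eq_zero_iff_mem]; exact hk⟩

end Dedekind

/-! ### Real polynomials -/

/-- If `d ≠ 0` and `d(x)² τ(x) ≥ 0` for all real `x`, then `τ ≥ 0` on `ℝ`. [folklore] -/
theorem eval_nonneg_of_sq_mul_eval_nonneg {d τ : ℝ[X]} (hd : d ≠ 0)
    (h : ∀ x : ℝ, 0 ≤ (d.eval x) ^ 2 * τ.eval x) (a : ℝ) : 0 ≤ τ.eval a := by
  by_contra hneg
  rw [not_le] at hneg
  have hev : ∀ᶠ x in nhds a, τ.eval x < 0 :=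
    (τ.continuous.tendsto a).eventually_lt_const hneg
  have hroot : ∀ᶠ x in nhds a, x ∈ {x | d.IsRoot x} := hev.mono fun x hx => by
    have h1 := h x
    have hsq : (d.eval x) ^ 2 = 0 :=
      le_antisymm (by nlinarith [sq_nonneg (d.eval x)]) (sq_nonneg _)
    exact pow_eq_zero_iff two_ne_zero |>.mp hsq
  exact hd (Polynomial.eq_zero_of_infinite_isRoot d (infinite_of_mem_nhds a hroot))

/-- A real polynomial which is non-negative on `ℝ` vanishes to second order at each of its
real zeros. [folklore] -/
theorem X_sub_C_sq_dvd_of_eval_nonneg {P : ℝ[X]} (h0 : ∀ x : ℝ, 0 ≤ P.eval x) {a : ℝ}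
    (ha : P.eval a = 0) : (X - C a) ^ 2 ∣ P := by
  have hmin : IsLocalMin (fun x => P.eval x) a :=
    Filter.Eventually.of_forall fun x => by
      show P.eval a ≤ P.eval x
      rw [ha]; exact h0 x
  have hder : P.derivative.eval a = 0 := by
    have := hmin.deriv_eq_zero
    rwa [Polynomial.deriv] at this
  obtain ⟨P₁, hP₁⟩ := dvd_iff_isRoot.mpr ha
  rw [hP₁, derivative_mul, derivative_sub, derivative_X, derivative_C, sub_zero, one_mul,
    eval_add, eval_mul, eval_sub, eval_X, eval_C, sub_self, zero_mul, add_zero] at hder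
  obtain ⟨P₂, hP₂⟩ := dvd_iff_isRoot.mpr hder
  rw [hP₁, hP₂, ← mul_assoc, ← pow_two]
  exact dvd_mul_right _ _

/-- Expansion of a monic quadratic under a ring homomorphism. [folklore] -/
theorem ringHom_apply_eq_of_natDegree_eq_two {S : Type*} [CommRing S] (φ : ℝ[X] →+* S)
    {g : ℝ[X]} (hg : g.Monic) (h2 : g.natDegree = 2) :
    φ g = φ (C (g.coeff 0)) + φ (C (g.coeff 1)) * φ X + φ X * φ X := by
  have hlead : g.coeff 2 = 1 := by rw [← h2]; exact hg
  conv_lhs => rw [← eval₂_C_X (p := g), hom_eval₂, eval₂_eq_sum_range, h2]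
  simp only [Finset.sum_range_succ, Finset.sum_range_zero, zero_add, pow_zero, mul_one, pow_one,
    RingHom.coe_comp, Function.comp_apply, hlead, map_one, one_mul, pow_two]

/-- A monic irreducible real quadratic `t² + bt + c` has `b² − 4c < 0`. [folklore] -/
theorem coeff_sq_sub_four_mul_coeff_neg {g : ℝ[X]} (hirr : Irreducible g) (hg : g.Monic)
    (h2 : g.natDegree = 2) : g.coeff 1 * g.coeff 1 - 4 * g.coeff 0 < 0 := by
  set b := g.coeff 1
  set c := g.coeff 0
  have hnoroot : ∀ r : ℝ, 1 * (r * r) + b * r + c ≠ 0 := by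
    intro r hr
    have hroot : g.IsRoot r := by
      have hexp := ringHom_apply_eq_of_natDegree_eq_two (evalRingHom r) hg h2
      simp only [coe_evalRingHom, eval_C, eval_X] at hexp
      rw [IsRoot.def, hexp]
      linarith
    obtain ⟨h', hh'⟩ := dvd_iff_isRoot.mpr hroot
    rcases hirr.isUnit_or_isUnit hh' with hu | hu
    · exact not_isUnit_X_sub_C r hu
    · rw [hh', natDegree_mul (X_sub_C_ne_zero r) hu.ne_zero, natDegree_X_sub_C,
        natDegree_eq_zero_of_isUnit hu] at h2
      omega
  by_contra hD
  rw [not_lt] at hD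
  set s := Real.sqrt (b * b - 4 * c)
  have hs : discrim 1 b c = s * s := by
    rw [discrim, sq, mul_one, Real.mul_self_sqrt hD]
  exact hnoroot _ ((quadratic_eq_zero_iff one_ne_zero hs ((-b + s) / (2 * 1))).mpr (Or.inl rfl))

/-! ### Positivity of the trace form of the normalisation at real fibres -/

section RealFibres

variable {K L B : Type*} [Field K] [Field L] [Algebra ℝ[X] K] [IsFractionRing ℝ[X] K]
  [Algebra K L] [Algebra ℝ[X] L] [IsScalarTower ℝ[X] K L] [FiniteDimensional K L]
  [Algebra.IsSeparable K L]
  [CommRing B] [IsDedekindDomain B] [Algebra ℝ[X] B] [Algebra B L] [IsScalarTower ℝ[X] B L]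
  [IsIntegralClosure B ℝ[X] L] [Module.Finite ℝ[X] B] [Module.IsTorsionFree ℝ[X] B]

omit [Algebra.IsSeparable K L] in
/-- **The trace form of `B | ℝ[x]` is positive semidefinite at every real point.** Let
`L = K(θ)`, `K = ℝ(x)`, with `θ` a root of the monic `f ∈ ℝ[x][t]` (`minpoly θ = f`) all of
whose fibres `f(a, ·)` are real rooted, and let `B` be the integral closure of `ℝ[x]` in `L`.
Then for every `u ∈ B` the polynomial `Tr_{B|ℝ[x]}(u²) ∈ ℝ[x]` is non-negative on `ℝ`.
(Clearing denominators `d u = h(θ)`, `d² Tr(u²) = Tr_{ℝ[x][t]/(f)}(h²)`, whose value at `a` is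
the trace of a square in `ℝ[t]/(f(a,·))`, non-negative by Sylvester.)
[cite: Hanselka2017, Cor. 3.1 (positivity of the trace form at real points)] -/
theorem eval_intTrace_mul_self_nonneg (pb : PowerBasis K L) {f : ℝ[X][X]} (hf : f.Monic)
    (hmin : minpoly K pb.gen = f.map (algebraMap ℝ[X] K))
    (hroots : ∀ a : ℝ, Multiset.card (f.map (evalRingHom a)).roots = f.natDegree)
    (u : B) (a : ℝ) : 0 ≤ (Algebra.intTrace ℝ[X] B (u * u)).eval a := by
  obtain ⟨P, D, hD0, hP, hPD⟩ :=
    Literature.FieldTheory.RealClosed.exists_sq_mul_trace_mul_self_eq hf hroots pb hmin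
      (algebraMap B L u)
  have hident : D ^ 2 * Algebra.intTrace ℝ[X] B (u * u) = P := by
    apply IsFractionRing.injective ℝ[X] K
    rw [map_mul, Algebra.algebraMap_intTrace (L := L), map_mul (algebraMap B L), hPD]
  refine eval_nonneg_of_sq_mul_eval_nonneg hD0 (fun x => ?_) a
  rw [← eval_pow, ← eval_mul, hident]
  exact hP x

omit [Algebra.IsSeparable K L] in
/-- **Second-order vanishing of traces on the radical of a real fibre.** Under the hypotheses
of `eval_intTrace_mul_self_nonneg`, for every real `a` and all `z, w` in the radical of
`(x − a)B`: `Tr_{B|ℝ[x]}(z w) ∈ (x − a)²ℝ[x]`. (`Tr(z²) ≥ 0` on `ℝ` vanishes at `a` since `z` is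
nilpotent modulo `(x − a)B`, hence to second order; polarise.) [folklore] -/
theorem intTrace_mul_mem_sq_of_realRooted (pb : PowerBasis K L) {f : ℝ[X][X]} (hf : f.Monic)
    (hmin : minpoly K pb.gen = f.map (algebraMap ℝ[X] K))
    (hroots : ∀ a : ℝ, Multiset.card (f.map (evalRingHom a)).roots = f.natDegree) (a : ℝ) :
    ∀ z ∈ ((Ideal.span {X - C a}).map (algebraMap ℝ[X] B)).radical,
      ∀ w ∈ ((Ideal.span {X - C a}).map (algebraMap ℝ[X] B)).radical,
        Algebra.intTrace ℝ[X] B (z * w) ∈ (Ideal.span {X - C a} : Ideal ℝ[X]) ^ 2 := by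
  set p : Ideal ℝ[X] := Ideal.span {X - C a} with hp
  haveI hpmax : p.IsMaximal :=
    PrincipalIdealRing.isMaximal_of_irreducible (irreducible_X_sub_C a)
  have key : ∀ u ∈ (p.map (algebraMap ℝ[X] B)).radical,
      Algebra.intTrace ℝ[X] B (u * u) ∈ p ^ 2 := by
    intro u hu
    have hmem : Algebra.intTrace ℝ[X] B (u * u) ∈ p :=
      intTrace_mem_of_mem_radical ℝ[X] (Ideal.mul_mem_left _ u hu)
    have heval : (Algebra.intTrace ℝ[X] B (u * u)).eval a = 0 := by
      rw [hp, Ideal.mem_span_singleton] at hmem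
      exact dvd_iff_isRoot.mp hmem
    rw [hp, Ideal.span_singleton_pow, Ideal.mem_span_singleton]
    exact X_sub_C_sq_dvd_of_eval_nonneg (eval_intTrace_mul_self_nonneg pb hf hmin hroots u) heval
  intro z hz w hw
  have hzw : z + w ∈ (p.map (algebraMap ℝ[X] B)).radical := Ideal.add_mem _ hz hw
  have h2 : (2 : ℝ[X]) * Algebra.intTrace ℝ[X] B (z * w) =
      Algebra.intTrace ℝ[X] B ((z + w) * (z + w)) - Algebra.intTrace ℝ[X] B (z * z) -
        Algebra.intTrace ℝ[X] B (w * w) := by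
    rw [show (z + w) * (z + w) = z * z + w * w + 2 • (z * w) by ring]
    simp only [map_add, map_nsmul]
    ring
  have hmem2 : (2 : ℝ[X]) * Algebra.intTrace ℝ[X] B (z * w) ∈ p ^ 2 := by
    rw [h2]
    exact Ideal.sub_mem _ (Ideal.sub_mem _ (key _ hzw) (key _ hz)) (key _ hw)
  have h3 : Algebra.intTrace ℝ[X] B (z * w) =
      C (1 / 2 : ℝ) * ((2 : ℝ[X]) * Algebra.intTrace ℝ[X] B (z * w)) := by
    rw [← mul_assoc, show (2 : ℝ[X]) = C 2 from rfl, ← C_mul]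
    norm_num
  rw [h3]
  exact Ideal.mul_mem_left _ _ hmem2

/-- **Hanselka 2017, Cor. 3.5 with Lemma 2.3 (no real ramification).** Let `K` be the
fraction field of `ℝ[x]`, `L = K(θ)` a finite extension with power basis generated by a root
`θ` of the monic `f ∈ ℝ[x][t]` (`minpoly_K θ = f`), all of whose fibres `f(a, ·)` (`a ∈ ℝ`) are
real rooted, and `B` the integral closure of `ℝ[x]` in `L`. Then for every `a ∈ ℝ` and every
prime `𝔮` of `B` containing `x − a`: `𝔮² ∤ (x − a)B` — the `(x − a)`-adic valuation is
unramified in `L|K` — and `𝔮 ∤ 𝔇_{B|ℝ[x]}`, i.e. `v_𝔮` of the codifferent `Δ(B|ℝ[x])`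
vanishes. [cite: Hanselka2017, Cor. 3.5 and Lemma 2.3 (as used in §5, proof of Thm. 1)] -/
theorem not_sq_dvd_and_not_dvd_differentIdeal_of_realRooted (pb : PowerBasis K L)
    {f : ℝ[X][X]} (hf : f.Monic) (hmin : minpoly K pb.gen = f.map (algebraMap ℝ[X] K))
    (hroots : ∀ a : ℝ, Multiset.card (f.map (evalRingHom a)).roots = f.natDegree) (a : ℝ)
    (q : Ideal B) [q.IsPrime] (hq : algebraMap ℝ[X] B (X - C a) ∈ q) :
    ¬ q ^ 2 ∣ (Ideal.span {X - C a}).map (algebraMap ℝ[X] B) ∧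
      ¬ q ∣ differentIdeal ℝ[X] B := by
  set p : Ideal ℝ[X] := Ideal.span {X - C a} with hp
  haveI hpmax : p.IsMaximal :=
    PrincipalIdealRing.isMaximal_of_irreducible (irreducible_X_sub_C a)
  haveI : Nontrivial (ℝ[X] ⧸ p) := Ideal.Quotient.nontrivial_iff.mpr hpmax.ne_top
  haveI : CharZero (ℝ[X] ⧸ p) :=
    charZero_of_injective_algebraMap (algebraMap ℝ (ℝ[X] ⧸ p)).injective
  have hp0 : p ≠ ⊥ := by
    rw [hp, Ne, Ideal.span_singleton_eq_bot]
    exact X_sub_C_ne_zero a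
  have hqdvd : q ∣ p.map (algebraMap ℝ[X] B) := by
    rw [Ideal.dvd_iff_le, hp, Ideal.map_span, Set.image_singleton, Ideal.span_le,
      Set.singleton_subset_iff]
    exact hq
  haveI := IsIntegralClosure.isFractionRing_of_finite_extension ℝ[X] K L B
  exact not_sq_dvd_and_not_dvd_differentIdeal_of_trace_radical ℝ[X] K L hp0
    (intTrace_mul_mem_sq_of_realRooted pb hf hmin hroots a) q hqdvd

/-- The same in Mathlib's language: every prime of `B` over a real point `x = a` is unramified
over `ℝ[x]` (`Algebra.IsUnramifiedAt`, via `not_dvd_differentIdeal_iff`).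
[cite: Hanselka2017, Cor. 3.5] -/
theorem isUnramifiedAt_of_realRooted (pb : PowerBasis K L) {f : ℝ[X][X]} (hf : f.Monic)
    (hmin : minpoly K pb.gen = f.map (algebraMap ℝ[X] K))
    (hroots : ∀ a : ℝ, Multiset.card (f.map (evalRingHom a)).roots = f.natDegree) (a : ℝ)
    (q : Ideal B) [q.IsPrime] (hq : algebraMap ℝ[X] B (X - C a) ∈ q) :
    Algebra.IsUnramifiedAt ℝ[X] q := by
  letI := FractionRing.liftAlgebra ℝ[X] (FractionRing B)
  haveI := FractionRing.isScalarTower_liftAlgebra ℝ[X] (FractionRing B)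
  haveI := IsIntegralClosure.isFractionRing_of_finite_extension ℝ[X] K L B
  haveI := Literature.NumberTheory.NumberFields.isSeparable_fractionRing_of_isSeparable ℝ[X] K L B
  exact not_dvd_differentIdeal_iff.mp
    (not_sq_dvd_and_not_dvd_differentIdeal_of_realRooted pb hf hmin hroots a q hq).2

/-- **Primes dividing the different are non-real** (the form in which Cor. 3.5 enters the
proof of Hanselka's Theorem 1, §5: "`v_𝔮(Δ) = 0` for all real primes `𝔮 ∈ 𝓘_B`", a prime being
*real* when its residue field is formally real). Under the hypotheses of
`not_sq_dvd_and_not_dvd_differentIdeal_of_realRooted`: if a non-zero prime `𝔮` of `B` divides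
the different `𝔇_{B|ℝ[x]}`, then `−1` is a square in `B/𝔮` (so the residue field of `𝔮` is
`ℂ`, not formally real). Indeed the prime of `ℝ[x]` below `𝔮` is generated by a monic
irreducible `g` of degree `1` or `2`; degree `1` is excluded by the previous theorem, and for
`g = t² + bt + c` (`b² − 4c < 0`) the class of `(2x + b)/√(4c − b²)` squares to `−1`.
[cite: Hanselka2017, Cor. 3.5 with Lemma 2.3 (§5, proof of Thm. 1)] -/
theorem exists_mul_self_eq_neg_one_of_dvd_differentIdeal (pb : PowerBasis K L) {f : ℝ[X][X]}
    (hf : f.Monic) (hmin : minpoly K pb.gen = f.map (algebraMap ℝ[X] K))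
    (hroots : ∀ a : ℝ, Multiset.card (f.map (evalRingHom a)).roots = f.natDegree)
    (q : Ideal B) [q.IsPrime] (hq0 : q ≠ ⊥) (hq : q ∣ differentIdeal ℝ[X] B) :
    ∃ i : B ⧸ q, i * i = -1 := by
  classical
  haveI : Algebra.IsIntegral ℝ[X] B := IsIntegralClosure.isIntegral_algebra ℝ[X] L
  set P0 : Ideal ℝ[X] := q.comap (algebraMap ℝ[X] B) with hP0def
  have hP0 : P0 ≠ ⊥ := fun h => hq0 (Ideal.eq_bot_of_comap_eq_bot h)
  haveI hP0p : P0.IsPrime := Ideal.comap_isPrime (algebraMap ℝ[X] B) q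
  set g := Submodule.IsPrincipal.generator P0 with hgdef
  have hgspan : Ideal.span {g} = P0 := Ideal.span_singleton_generator P0
  have hgmem : g ∈ P0 := Submodule.IsPrincipal.generator_mem P0
  have hg0 : g ≠ 0 := by
    intro h
    apply hP0
    rw [← hgspan, h, Ideal.span_singleton_eq_bot]
  have hgprime : Prime g := by
    rw [← Ideal.span_singleton_prime hg0, hgspan]
    exact hP0p
  set g' := g * C (g.leadingCoeff)⁻¹ with hg'
  have hg'irr : Irreducible g' :=
    Polynomial.irreducible_mul_leadingCoeff_inv.mpr hgprime.irreducible
  have hg'mon : g'.Monic := Polynomial.monic_mul_leadingCoeff_inv hg0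
  have hg'mem : algebraMap ℝ[X] B g' ∈ q := by
    rw [hg', map_mul]
    exact Ideal.mul_mem_right _ _ (Ideal.mem_comap.mp hgmem)
  have hdeg2 := hg'irr.natDegree_le_two
  have hdeg1 : 0 < g'.natDegree :=
    Polynomial.natDegree_pos_iff_degree_pos.mpr (degree_pos_of_irreducible hg'irr)
  rcases (show g'.natDegree = 1 ∨ g'.natDegree = 2 by omega) with h1 | h2
  · -- a real point below `q`: contradiction with the main theorem
    exfalso
    have hlin : g' = X - C (-(g'.coeff 0)) := by
      rw [map_neg, sub_neg_eq_add]
      exact hg'mon.eq_X_add_C h1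
    rw [hlin] at hg'mem
    exact (not_sq_dvd_and_not_dvd_differentIdeal_of_realRooted pb hf hmin hroots _ q hg'mem).2 hq
  · -- an irreducible quadratic below `q`: `−1` is a square in `B/q`
    set b := g'.coeff 1 with hb
    set c := g'.coeff 0 with hc
    have hdisc : b * b - 4 * c < 0 := coeff_sq_sub_four_mul_coeff_neg hg'irr hg'mon h2
    set E := 4 * c - b * b with hE
    have hEpos : 0 < E := by linarith
    set ψ : ℝ[X] →+* B ⧸ q := (Ideal.Quotient.mk q).comp (algebraMap ℝ[X] B) with hψ
    set φ : ℝ →+* B ⧸ q := ψ.comp C with hφ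
    have hψg : ψ g' = 0 := by
      rw [hψ, RingHom.comp_apply, Ideal.Quotient.eq_zero_iff_mem]
      exact hg'mem
    have hrel : ψ X * ψ X + φ b * ψ X + φ c = 0 := by
      have hexp := ringHom_apply_eq_of_natDegree_eq_two ψ hg'mon h2
      rw [hψg] at hexp
      rw [hφ, RingHom.comp_apply, RingHom.comp_apply]
      linear_combination -hexp
    have hsq : 1 / Real.sqrt E * (1 / Real.sqrt E) = 1 / E := by
      rw [div_mul_div_comm, one_mul, Real.mul_self_sqrt hEpos.le]
    refine ⟨φ (1 / Real.sqrt E) * (2 * ψ X + φ b), ?_⟩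
    calc φ (1 / Real.sqrt E) * (2 * ψ X + φ b) * (φ (1 / Real.sqrt E) * (2 * ψ X + φ b))
        = φ (1 / Real.sqrt E * (1 / Real.sqrt E)) *
            (4 * (ψ X * ψ X + φ b * ψ X + φ c) + (φ b * φ b - 4 * φ c)) := by
          rw [map_mul]; ring
      _ = φ (1 / E * (b * b - 4 * c)) := by
          rw [hsq, hrel, mul_zero, zero_add, map_mul, map_sub, map_mul, map_mul, map_ofNat]
      _ = -1 := by
          rw [show 1 / E * (b * b - 4 * c) = -1 by
            rw [show b * b - 4 * c = -E by rw [hE]; ring, mul_neg, one_div,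
              inv_mul_cancel₀ hEpos.ne']]
          rw [map_neg, map_one]

end RealFibres

end Literature.AlgebraicGeometry.DeterminantalHypersurfaces
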